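import Literature.Computation.Certificates.SumOfSquares
import Mathlib
import HarnessLib

/-!
# Single machine – infinite bus (SMIB), classical model `M_smib`, and its polynomial recast

Venture GRIDFUSION (LADDER-GRIDFUSION rungs G3 → G1.SMIB), cell `run/shared/lean/pub/gridfusion/`,
`plan/PARTITION.md` §0 row `Models/` and amendment A1 (seat gridfusion-model-1).

## The model AS PRINTED

P. M. Anderson, A. A. Fouad, *Power System Control and Stability* (1977), §2.7 "System of one
machine against an infinite bus — the classical model", assumptions 1–5, eqs. (2.40)–(2.42)
[galaxy:panama:353492988330019]: the electrical power out of the internal node is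
`P_e = P_C + P_M sin(δ − γ)` (2.41) with `P_C = E²G₁₁`, `P_M = E V Y₁₂`, `γ = θ₁₂ − π/2`, and the
swing equation is `dδ/dt = ω − ω_R`, `dω/dt = (ω_R/2H)(P_m − P_e)` (2.42); a damping power
`D·(speed deviation)` "is frequently added" (A–F §2.9 ¶2; Sauer–Pai *Power System Dynamics and
Stability* (1998) §5.6–5.7 eqs. (5.155), (5.157) `T_D = D(ω − ω_s)` [galaxy:panama:353827995779076]).
We type it in DEVIATION form with `M = 2H/ω_R` and `ω` the speed deviation:
`dδ/dt = ω`, `M dω/dt = P_m − P_C − P_M sin(δ − γ) − D ω`.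

MODELLED (cell three-column rule, README §3 T2/T7): every declaration is about the model
`M_smib`; absent effects = those of the classical model (A–F §2.11) plus the infinite-bus
idealisation (constant voltage and frequency at the remote bus); validity row
`plan/MODEL-VALIDITY.md` (model-2). No declaration says a machine or grid is stable.

## The polynomial recast (PARTITION A1, convention PICKED by model-1: deviation coordinates)

Printed recast: S. Kundu, M. Anghel, *Stability and control of power systems using vector
Lyapunov functions and sum-of-squares methods*, ECC 2015 (arXiv:1503.07541) §6.2 — for every
independent angle `z_{2i−1} = sin(δ)`, `z_{2i} = 1 − cos(δ)` after the shift `δ → δ + δ^s`, speeds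
unchanged, equality constraints `z_{2i−1}² + z_{2i}² − 2 z_{2i} = 0`, equilibrium mapped to `z = 0`
[corpus:paper:arxiv-1503.07541 p.10]; the same recast is Anghel–Milano–Papachristodoulou,
IEEE TCAS-I 60 (2013) (lit-1 register).

With `u = δ − δ^s` and `(s^*, c^*) = (sin(δ^s − γ), cos(δ^s − γ))` — by A1 a RATIONAL point of the
unit circle supplied by model-4, the mechanical power being REDEFINED as `P_m' = P_C + P_M s^*` so
that `δ^s` is an exact equilibrium — the recast state is `z = (σ, κ, ω) = (sin u, 1 − cos u, ω)`
(SOS variable indices `0, 1, 2`) and the dynamics are POLYNOMIAL with `f(0) = 0`: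

  `dσ/dt = (1 − κ) ω`,  `dκ/dt = σ ω`,  `dω/dt = −a σ + b κ − d ω`,  `h(z) = σ² + κ² − 2κ = 0`,

where `a = P_M c^*/M`, `b = P_M s^*/M`, `d = D/M`. These are the objects the SOS toolchains
consume VERBATIM (interface I2, `models/SMIB-poly.json` mirrors the decls below) and that
sos-5's Bench theorems quantify over.

## Contents

* `SMIB` (parameters), `SMIB.Pe` (2.41), `SMIB.field` (2.42)+(5.157), `SMIB.IsEquilibrium`,
  `isEquilibrium_iff`, `SMIB.IsSolutionOn`, `SMIB.energy` (A–F §2.8 / Sauer–Pai §9.6.2 energy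
  integral, original coordinates only — not polynomial in `z`);
* recast DATA in the tree's certificate vocabulary `Literature.Computation.Certificates.SOS.Poly`:
  `SMIB.fσ`, `SMIB.fκ`, `SMIB.fω a b d`, `SMIB.polyField a b d`, `SMIB.hcon`;
* the embedding `SMIB.embed δs : ℝ × ℝ → (ℕ → ℝ)` (`= SOS.vars [sin u, 1 − cos u, ω]`) and the
  EXACT EMBEDDING LEMMAS: `hcon_eval_embed` (the constraint holds identically),
  `embed_equilibrium` (equilibrium ↦ `0`), `fσ_eval_embed`, `fκ_eval_embed`, `fω_eval_embed`
  (the polynomial field is the push-forward of `field` under `embed`, given the A1 relations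
  `ha hb hd hP`), and `hasDerivWithinAt_embed` (solutions of `M_smib` are carried to curves whose
  coordinates satisfy `dz_k/dt = f_k(z)` — the chain rule, so a certified inequality
  `∇V·f ≤ …` on `{h = 0} ∩ D` IS the derivative of `V ∘ embed` along true solutions).

Instances (numerical `a b d` with provenance) are NOT declared here: exact data is model-4's
custody (`bench/data/SMIB/`), the Bench files are sos-5's. The printed A–F Examples 2.3–2.5
(H = 5 s via `ω_R/2H = 37.7`, `P_m = 0.8`, `P_e = 2.222 / 1.010 / 1.587 sin δ` pre-fault /
faulted / cleared, `D = 0`) are quoted in `models/SMIB-poly.json` as a VALIDATED cross-check only.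
-/

noncomputable section

open Real
open Literature.Computation.Certificates
open Literature.Computation.Certificates.SOS

namespace Summit.Ventures.GridStability.Models

/-- Parameters of the classical single-machine–infinite-bus model `M_smib`
(Anderson–Fouad §2.7 (2.40)–(2.42), damping per §2.9 ¶2 / Sauer–Pai (5.157)): `M = 2H/ω_R`,
damping `D`, mechanical power `Pm`, `PC = E² G₁₁`, `PM = E V Y₁₂`, `γ = θ₁₂ − π/2`
(`PC = 0`, `γ = 0` for a purely reactive network with no local load, A–F remark after (2.41)).
MODELLED: absent effects = classical-model list (A–F §2.11) + infinite bus;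
MODEL-VALIDITY.md row `smib-classical`. -/
structure SMIB where
  /-- inertia coefficient `M = 2H/ω_R` -/
  M : ℝ
  /-- damping coefficient (multiplies the speed deviation) -/
  D : ℝ
  /-- mechanical power input `P_m` -/
  Pm : ℝ
  /-- `P_C = E² G₁₁` -/
  PC : ℝ
  /-- `P_M = E V Y₁₂` -/
  PM : ℝ
  /-- `γ = θ₁₂ − π/2` -/
  γ : ℝ

namespace SMIB

variable (p : SMIB)

/-- Electrical power output, Anderson–Fouad (2.41): `P_e(δ) = P_C + P_M sin(δ − γ)`. -/
def Pe (δ : ℝ) : ℝ := p.PC + p.PM * sin (δ - p.γ)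

/-- The SMIB vector field on the state `(δ, ω)` (`ω` = speed deviation, rad/s),
Anderson–Fouad (2.42) with the damping torque Sauer–Pai (5.157):
`dδ/dt = ω`, `dω/dt = (P_m − P_e(δ) − D ω)/M`. -/
def field (x : ℝ × ℝ) : ℝ × ℝ := (x.2, (p.Pm - p.Pe x.1 - p.D * x.2) / p.M)

/-- `δ^s` is an equilibrium angle of `M_smib`: `P_e(δ^s) = P_m` (A–F: "the intersection of
`P_m` with the power-angle curve", §2.8). -/
def IsEquilibrium (δs : ℝ) : Prop := p.Pe δs = p.Pm

/-- The equilibrium condition unfolded: `P_M sin(δ^s − γ) = P_m − P_C`. -/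
theorem isEquilibrium_iff (δs : ℝ) :
    p.IsEquilibrium δs ↔ p.PM * sin (δs - p.γ) = p.Pm - p.PC := by
  unfold IsEquilibrium Pe
  constructor <;> intro h <;> linarith

/-- The field vanishes at `(δ^s, 0)` for an equilibrium angle. -/
theorem field_equilibrium {δs : ℝ} (h : p.IsEquilibrium δs) : p.field (δs, 0) = 0 := by
  unfold IsEquilibrium at h
  simp [field, h]

/-- A curve `γ : ℝ → ℝ × ℝ` solves `M_smib` on the time set `s`
(tree convention: `HasDerivWithinAt` within `s` at every `t ∈ s`). -/
def IsSolutionOn (c : ℝ → ℝ × ℝ) (s : Set ℝ) : Prop :=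
  ∀ t ∈ s, HasDerivWithinAt c (p.field (c t)) s t

/-- The classical SMIB energy function relative to the equilibrium angle `δ^s`
(kinetic + potential energy, the integral of the accelerating power of A–F §2.8 (2.43)–(2.50);
Sauer–Pai §9.6.2): `V(δ, ω) = ½ M ω² − (P_m − P_C)(δ − δ^s) − P_M (cos(δ − γ) − cos(δ^s − γ))`.
Original coordinates only: the term `(δ − δ^s)` is not polynomial in `(sin u, 1 − cos u)`. -/
def energy (δs : ℝ) (x : ℝ × ℝ) : ℝ :=
  p.M * x.2 ^ 2 / 2 - (p.Pm - p.PC) * (x.1 - δs) - p.PM * (cos (x.1 - p.γ) - cos (δs - p.γ))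

/-! ### The polynomial recast (deviation convention, PARTITION A1) -/

/-- Recast component `dσ/dt = (1 − κ) ω` as an `SOS.Poly` in the variables
`z = (σ, κ, ω) ↦ (0, 1, 2)`: `ω − κ ω`. -/
def fσ : Poly := [(([0, 0, 1] : List ℕ), (1 : ℚ)), (([0, 1, 1] : List ℕ), (-1 : ℚ))]

/-- Recast component `dκ/dt = σ ω`. -/
def fκ : Poly := [(([1, 0, 1] : List ℕ), (1 : ℚ))]

/-- Recast component `dω/dt = −a σ + b κ − d ω` with the RATIONAL data
`a = P_M c^*/M`, `b = P_M s^*/M`, `d = D/M` (model-4, `bench/data/SMIB/params.json`). -/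
def fω (a b d : ℚ) : Poly :=
  [(([1] : List ℕ), -a), (([0, 1] : List ℕ), b), (([0, 0, 1] : List ℕ), -d)]

/-- The recast SMIB vector field `f = (f_σ, f_κ, f_ω)` as a list of `SOS.Poly`, component `k`
being the time derivative of variable `k` (interface I2: consumed verbatim by toolchains A/B and
by sos-5's Bench theorems). `f(0) = 0` holds coefficientwise (no constant terms). -/
def polyField (a b d : ℚ) : List Poly := [fσ, fκ, fω a b d]

/-- The recast equality constraint `h(z) = σ² + κ² − 2κ` (`= 0` on the image of the embedding),
Kundu–Anghel 2015 §6.2 (constraint). -/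
def hcon : Poly :=
  [(([2] : List ℕ), (1 : ℚ)), (([0, 2] : List ℕ), (1 : ℚ)), (([0, 1] : List ℕ), (-2 : ℚ))]

/-- The embedding of the SMIB state into the recast variables relative to the equilibrium angle
`δ^s`: `(δ, ω) ↦ z = (sin(δ − δ^s), 1 − cos(δ − δ^s), ω)` as an SOS point `ℕ → ℝ`
(indices `≥ 3` read `0`). -/
def embed (δs : ℝ) (x : ℝ × ℝ) : ℕ → ℝ := vars [sin (x.1 - δs), 1 - cos (x.1 - δs), x.2]

/-- Coordinate `0` of the embedding is `σ = sin(δ − δ^s)`. -/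
@[simp] theorem embed_zero (δs : ℝ) (x : ℝ × ℝ) : embed δs x 0 = sin (x.1 - δs) := rfl
/-- Coordinate `1` of the embedding is `κ = 1 − cos(δ − δ^s)`. -/
@[simp] theorem embed_one (δs : ℝ) (x : ℝ × ℝ) : embed δs x 1 = 1 - cos (x.1 - δs) := rfl
/-- Coordinate `2` of the embedding is the speed deviation `ω`. -/
@[simp] theorem embed_two (δs : ℝ) (x : ℝ × ℝ) : embed δs x 2 = x.2 := rfl

/-- The equilibrium state `(δ^s, 0)` is mapped to the origin `z = 0`. -/
theorem embed_equilibrium (δs : ℝ) (k : ℕ) : embed δs (δs, 0) k = 0 := by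
  unfold embed
  match k with
  | 0 => simp
  | 1 => simp
  | 2 => simp
  | k + 3 => simp [vars]

/-- The recast constraint holds identically on the image of the embedding:
`h(embed(δ, ω)) = sin²u + (1 − cos u)² − 2(1 − cos u) = 0`. -/
theorem hcon_eval_embed (δs : ℝ) (x : ℝ × ℝ) : hcon.eval (embed δs x) = 0 := by
  simp only [hcon, embed, Poly.eval_cons, Poly.eval_nil, Monomial.eval_eq, Monomial.evalFrom_cons,
    Monomial.evalFrom_nil, vars_cons_zero, vars_cons_succ]
  push_cast
  nlinarith [sin_sq_add_cos_sq (x.1 - δs)]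

/-- `f_σ` on the image of the embedding is `cos(u)·ω`, the time derivative of `σ = sin u`
along `dδ/dt = ω`. -/
theorem fσ_eval_embed (δs : ℝ) (x : ℝ × ℝ) :
    fσ.eval (embed δs x) = cos (x.1 - δs) * x.2 := by
  simp only [fσ, embed, Poly.eval_cons, Poly.eval_nil, Monomial.eval_eq, Monomial.evalFrom_cons,
    Monomial.evalFrom_nil, vars_cons_zero, vars_cons_succ]
  push_cast
  ring

/-- `f_κ` on the image of the embedding is `sin(u)·ω`, the time derivative of `κ = 1 − cos u`. -/
theorem fκ_eval_embed (δs : ℝ) (x : ℝ × ℝ) :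
    fκ.eval (embed δs x) = sin (x.1 - δs) * x.2 := by
  simp only [fκ, embed, Poly.eval_cons, Poly.eval_nil, Monomial.eval_eq, Monomial.evalFrom_cons,
    Monomial.evalFrom_nil, vars_cons_zero, vars_cons_succ]
  push_cast
  ring

/-- **Faithfulness of the recast `ω̇`-component.** If the rational data satisfy the A1
relations `a = P_M cos(δ^s − γ)/M`, `b = P_M sin(δ^s − γ)/M`, `d = D/M`, `M ≠ 0`, and `δ^s` is an
equilibrium (`P_m = P_C + P_M sin(δ^s − γ)`, i.e. the REDEFINED `P_m'` of A1), then on the image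
of the embedding `f_ω(z) = (P_m − P_e(δ) − Dω)/M`, the `ω̇` of `M_smib` — by the sine addition
formula `sin(δ − γ) = sin u · c^* + cos u · s^*`. -/
theorem fω_eval_embed {a b d : ℚ} {δs : ℝ} (hM : p.M ≠ 0)
    (ha : (a : ℝ) = p.PM * cos (δs - p.γ) / p.M) (hb : (b : ℝ) = p.PM * sin (δs - p.γ) / p.M)
    (hd : (d : ℝ) = p.D / p.M) (hP : p.IsEquilibrium δs) (x : ℝ × ℝ) :
    (fω a b d).eval (embed δs x) = (p.field x).2 := by
  rw [isEquilibrium_iff] at hP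
  simp only [fω, embed, field, Pe, Poly.eval_cons, Poly.eval_nil, Monomial.eval_eq,
    Monomial.evalFrom_cons, Monomial.evalFrom_nil, vars_cons_zero, vars_cons_succ]
  push_cast
  rw [ha, hb, hd]
  have hsplit : x.1 - p.γ = (x.1 - δs) + (δs - p.γ) := by ring
  rw [hsplit, sin_add]
  field_simp
  linear_combination hP

/-- **Exact embedding lemma (chain rule).** Along any solution `c` of `M_smib` on `s`, the
recast curve `t ↦ embed δ^s (c t)` satisfies, coordinate by coordinate,
`d z_k/dt = f_k(z)` within `s` (`k = 0, 1, 2`), under the A1 data relations. Hence for any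
polynomial `V(z)`, `d/dt V(z(t)) = Σ_k ∂_kV · f_k` evaluated on `{h = 0}` — the quantity an SOS
certificate bounds. -/
theorem hasDerivWithinAt_embed {a b d : ℚ} {δs : ℝ} (hM : p.M ≠ 0)
    (ha : (a : ℝ) = p.PM * cos (δs - p.γ) / p.M) (hb : (b : ℝ) = p.PM * sin (δs - p.γ) / p.M)
    (hd : (d : ℝ) = p.D / p.M) (hP : p.IsEquilibrium δs) {c : ℝ → ℝ × ℝ} {s : Set ℝ}
    (hc : p.IsSolutionOn c s) {t : ℝ} (ht : t ∈ s) (k : Fin 3) :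
    HasDerivWithinAt (fun τ => embed δs (c τ) k)
      (((polyField a b d).getD k []).eval (embed δs (c t))) s t := by
  have h := hc t ht
  have h1 : HasDerivWithinAt (fun τ => (c τ).1) (p.field (c t)).1 s t := by
    simpa using h.hasFDerivWithinAt.fst.hasDerivWithinAt
  have h2 : HasDerivWithinAt (fun τ => (c τ).2) (p.field (c t)).2 s t := by
    simpa using h.hasFDerivWithinAt.snd.hasDerivWithinAt
  have h1' : HasDerivWithinAt (fun τ => (c τ).1 - δs) (c t).2 s t := by
    simpa [field] using h1.sub_const δs
  fin_cases k
  · -- σ = sin u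
    simp only [polyField, List.getD_cons_zero, fσ_eval_embed]
    simpa [embed, mul_comm] using h1'.sin
  · -- κ = 1 - cos u
    simp only [polyField, List.getD_cons_succ, List.getD_cons_zero, fκ_eval_embed]
    have := (h1'.cos).const_sub 1
    simpa [embed, mul_comm] using this
  · -- ω
    simp only [polyField, List.getD_cons_succ, List.getD_cons_zero,
      p.fω_eval_embed hM ha hb hd hP]
    simpa [embed] using h2

end SMIB

end Summit.Ventures.GridStability.Models
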